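import Literature.NumberTheory.LFunctions.KeiperLiZeroSum
import Literature.NumberTheory.LFunctions.RiemannHypothesisUpTo1000X
import Literature.NumberTheory.DiophantineGeometry.NamedHypothesesRHProofs
import Summits.RiemannHypothesis.RiemannHypothesis.Theorems.Splittings.LiIndexSetsPrelims
import Summits.RiemannHypothesis.RiemannHypothesis.Theorems.Splittings.LiCriterionProgressionsBL
import Summits.RiemannHypothesis.Statement
import HarnessLib

/-!
# Li's criterion along RESIDUE CLASSES `n ≡ t (mod q)` with a verified height as load-bearing input — part 1/3:
# prelims (the reflected point `(1 − 1/ρ̄')`, recurrence along multiples of `L`, the PHASE of `1 − 1/ρ`, small facts on the zeros)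


**New kernel statement.**  Let `H ≥ 1` be a verified height (`RiemannHypothesisUpTo H`: every zero with
`0 < Im ρ ≤ H` is on the line), `q ≥ 1` a modulus and `t ∈ ℤ` a shift with `|t| < (π/2)(H − 1/4)`.  Then for
every constant `C`

  `(∀ n ≥ 1, n ≡ t (mod q) → λ_n ≥ −C) → RH`   (`riemannHypothesis_of_keiperLiCoeff_bddBelow_modEq`),

hence `RH ↔ (λ_n)_{n ≡ t (q)}` bounded below `↔` nonneg `↔` any slack co-finite tail of the class.  With the tree's
KERNEL-checked `riemannHypothesisUpTo_1000` this is unconditional for all `|t| ≤ 1570`, i.e. for EVERY residue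
class of EVERY modulus `q ≤ 3141` (`riemannHypothesis_iff_keiperLiCoeff_bddBelow_mod_of_le`).  g2 proved the
class `t = 0` (`LiCriterionProgressionsBL`, no height needed) and showed that NO class `t ≢ 0` can be decided at
the level of Bombieri–Lagarias multisets (witness `1 − 1/ρ = ± i r`); the arithmetic input that rescues `ζ` is
exactly a zero-free height, entering LINEARLY: height `H` buys the shifts `|t| < (π/2)(H − 1/4)`.

PROOF (Bombieri–Lagarias' Theorem 1 (c)⇒(a) with a constrained recurrence).  In BL's proof the exponent `n` is
produced by simultaneous recurrence of the finitely many dominant `w_i/λ` (`|w_i| = λ` maximal); we run the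
recurrence along multiples of `qL` (Bolzano–Weierstrass for `k ↦ (z_i^{kqL})_i`) with accuracy `ε`, and then
shift by `s = |t|`: `n = d·qL ± s ≡ t (mod q)`, `Re (z_i^n) ≥ Re(z_i^{±s}) − ε`.  So what is needed is a uniform
PHASE CONDITION at exponent `s` on the off-line zeros: `Re(w^s) ≥ c₀ |w|^s`, `c₀ > 0`.  For `ζ`, an off-line zero
`ρ = β + iγ` has `|γ| > H` under `RiemannHypothesisUpTo H` (conjugation symmetry for `γ < 0`), and for
`z = 1 − 1/ρ`: `|arg z| ≤ |Im z|/Re z ≤ 1/(|γ| − 1/4)`, so `s·|arg z| ≤ s/(H − 1/4) =: Θ₀ < π/2` and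
`Re(z^s) = |z|^s cos(s arg z) ≥ |z|^s cos Θ₀`.  SHARP at multiset level: a conjugate pair with
`arg(1 − 1/ρ) = ± π/(2s)` (so `s·θ = π/2`, `cos = 0`) has ALL its Li sums along `n ≡ s (mod 4s)` equal to `2`
(`LiResidueBL.sharp_pair_sum`), whatever its modulus `r > 1`.

References: E. Bombieri, J. C. Lagarias, J. Number Theory 77 (1999) 274–287, Theorem 1 [BombieriLagarias1999];
X.-J. Li, J. Number Theory 65 (1997) 325–333 [Li1997]; R. P. Brent, Math. Comp. 33 (1979) [Brent1979] (height 1000,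
here the tree's kernel certificate `riemannHypothesisUpTo_1000`); D. Platt, T. Trudgian, Bull. LMS 53 (2021) (F1).

This part (1/3) carries the definition-free preliminaries in the helper namespace `LiResidueBL`; part 2/3 (`…BLEngine`) runs
Bombieri–Lagarias' (c)⇒(a) with a CONSTRAINED exponent; part 3/3 (`…BL`) states the theorems for `ζ`.

Provenance: cell rh-split, seat rh-split-li-finite g3, raw zero-def file `HOME/rh-split-li-finite/LiCriterionResidueClassesBL.lean`
(sha16 6ac0174b44e3a51a, 977 lines; proofs verbatim), filed in three parts ≤ 400 lines by rh-split-typer-1 g2 (INBOX 22:27Z item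
(6c)): `…BLPrelims` (§0 elementary facts not already in `LiIndexSetsPrelims`, §1 recurrence along multiples, §3 the phase of
`1 − 1/ρ`, small facts on the zeros), `…BLEngine` (§2 Bombieri–Lagarias (c)⇒(a) with a constrained exponent), `…BL` (§4 the
theorems for `ζ`).  The Bombieri–Lagarias helper lemmas of the scratch's §0 that coincide verbatim with the landed `Splittings/LiIndexSetsPrelims.lean`
(p468824), and the four small facts shared with `LiCriterionProgressionsBL.lean` (`LiProgressionBL.norm_one_sub_one_div_le_one_iff`,
`coe_ne_zero`, `toNat_order_cast`, `riemannHypothesis_of_forall_half_le_re`), are imported from there, not restated.  Typer-1 g2 replay of the 977-line raw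
file: farm rc 0, 0 warnings, 0 sorry; `#print axioms` = [propext, Classical.choice, Quot.sound] on
`riemannHypothesis_of_keiperLiCoeff_bddBelow_modEq` and `riemannHypothesis_iff_keiperLiCoeff_bddBelow_mod_of_le`; read-back:
`RiemannHypothesisUpTo H` occurs only as a hypothesis binder, the kernel instances cite `riemannHypothesisUpTo_1000` by name.

HONEST LABEL: SPLITTING SEARCH over kernel-typed RH-EQUIVALENCES; a splitting A ∧ B ⟹ RH is CONDITIONAL bookkeeping unless A
and B are both proved; nothing here bears on the truth of RH.
-/

noncomputable section

-- D-0017: `Summit.<S>.<S>.…` is the designed namespace of a single-problem summit.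
set_option linter.dupNamespace false

namespace Summit.RiemannHypothesis.RiemannHypothesis.Theorems.Splittings

open Filter Topology Complex
open scoped ComplexConjugate
open Literature.NumberTheory.LFunctions
open Literature.NumberTheory.LFunctions.BombieriLagarias
open Literature.NumberTheory.LFunctions.ZetaZeros
open Literature.NumberTheory.DiophantineGeometry (RiemannHypothesisUpTo)
open Summit.RiemannHypothesis.RiemannHypothesis.Theorems.Splittings.LiIndexSets
open Summit.RiemannHypothesis.RiemannHypothesis.Theorems.Splittings.LiProgressionBL

namespace LiResidueBL

/-! ## §0 Elementary facts about `w = (1 − 1/ρ)⁻¹` (the tree's private Bombieri–Lagarias helpers, re-proved) -/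











/-- `(1 − 1/(1 − ρ̄))⁻¹ = conj(1 − 1/ρ)` for `ρ ≠ 0, 1` (the reflection `ρ ↦ 1 − ρ̄`). -/
theorem inv_one_sub_inv_one_sub_conj {ρ : ℂ} (h0 : ρ ≠ 0) (h1 : ρ ≠ 1) :
    (1 - 1 / (1 - conj ρ))⁻¹ = conj (1 - 1 / ρ) := by
  have h0' : conj ρ ≠ 0 := (map_ne_zero _).2 h0
  have h1c : conj ρ ≠ 1 := fun h ↦ h1 (by simpa using congrArg conj h)
  have h1' : (1 : ℂ) - conj ρ ≠ 0 := sub_ne_zero.2 (Ne.symm h1c)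
  rw [map_sub, map_one, map_div₀, map_one, one_sub_div h1', inv_div,
    show (1 : ℂ) - conj ρ - 1 = -conj ρ by ring]
  field_simp
  ring

/-- Phase composition: if `‖v‖ ≤ 1`, `c₀ ≤ Re v` and `‖u − 1‖ < δ`, then `Re(u v) > c₀ − δ`. -/
theorem sub_lt_re_mul {u v : ℂ} {c₀ δ : ℝ} (hv : ‖v‖ ≤ 1) (hc : c₀ ≤ v.re) (hu : ‖u - 1‖ < δ) :
    c₀ - δ < (u * v).re := by
  have h1 : u * v = v + (u - 1) * v := by ring
  have h2 : -((u - 1) * v).re ≤ ‖(u - 1) * v‖ := by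
    have := Complex.re_le_norm (-((u - 1) * v))
    rwa [neg_re, norm_neg] at this
  have h3 : ‖(u - 1) * v‖ ≤ ‖u - 1‖ := by
    rw [norm_mul]; exact mul_le_of_le_one_right (norm_nonneg _) hv
  rw [h1, add_re]
  linarith

/-! ## §1 Simultaneous recurrence ALONG MULTIPLES of `L`, with accuracy `ε` -/

/-- For finitely many unit complex numbers `z_i`, any `L` and `ε > 0` there is `d ≥ 1` with
`‖z_i^{dL} − 1‖ < ε` for all `i` (Bolzano–Weierstrass for `k ↦ (z_i^{kL})_i`). -/
theorem exists_mul_norm_pow_sub_one_lt {ι : Type*} (B : Finset ι) (z : ι → ℂ)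
    (hz : ∀ i ∈ B, ‖z i‖ = 1) (L : ℕ) {ε : ℝ} (hε : 0 < ε) :
    ∃ d : ℕ, 1 ≤ d ∧ ∀ i ∈ B, ‖z i ^ (d * L) - 1‖ < ε := by
  classical
  set x : ℕ → (B → ℂ) := fun k i ↦ z i ^ (k * L) with hx
  have hxmem : ∀ k, x k ∈ Metric.closedBall (0 : B → ℂ) 1 := by
    intro k
    rw [Metric.mem_closedBall, dist_zero_right, pi_norm_le_iff_of_nonneg zero_le_one]
    intro i
    simp only [hx, norm_pow, hz i i.2, one_pow, le_refl]
  obtain ⟨a, -, φ, hφ, hlim⟩ := tendsto_subseq_of_bounded Metric.isBounded_closedBall hxmem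
  obtain ⟨K, hK⟩ := Metric.tendsto_atTop.1 hlim (ε / 2) (half_pos hε)
  have hd : dist (x (φ (K + 1))) (x (φ K)) < ε := by
    calc dist (x (φ (K + 1))) (x (φ K)) ≤ dist (x (φ (K + 1))) a + dist (x (φ K)) a :=
          dist_triangle_right _ _ _
      _ < ε / 2 + ε / 2 := add_lt_add (hK _ (Nat.le_succ K)) (hK _ le_rfl)
      _ = ε := by ring
  have hlt : φ K < φ (K + 1) := hφ (Nat.lt_succ_self K)
  obtain ⟨d, hd'⟩ := Nat.exists_eq_add_of_lt hlt
  refine ⟨d + 1, by omega, fun i hi ↦ ?_⟩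
  have hi' := (dist_pi_lt_iff hε).1 hd ⟨i, hi⟩
  rw [dist_eq_norm] at hi'
  simp only [hx] at hi'
  have hfac : z i ^ (φ (K + 1) * L) - z i ^ (φ K * L) =
      z i ^ (φ K * L) * (z i ^ ((d + 1) * L) - 1) := by
    rw [hd', show (φ K + d + 1) * L = φ K * L + (d + 1) * L by ring, pow_add]
    ring
  rwa [hfac, norm_mul, norm_pow, hz i hi, one_pow, one_mul] at hi'

/-! ## §3 The phase of `z = 1 − 1/ρ` -/

/-- `Re(z^s) = |z|^s cos(s · arg z)`. -/
theorem re_pow_eq_norm_pow_mul_cos (z : ℂ) (s : ℕ) :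
    (z ^ s).re = ‖z‖ ^ s * Real.cos (s * Complex.arg z) := by
  have h : z ^ s = ((‖z‖ ^ s : ℝ) : ℂ) * Complex.exp ((((s : ℝ) * Complex.arg z : ℝ) : ℂ) * Complex.I) := by
    calc z ^ s = ((‖z‖ : ℂ) * Complex.exp (Complex.arg z * Complex.I)) ^ s := by
          rw [Complex.norm_mul_exp_arg_mul_I]
      _ = (‖z‖ : ℂ) ^ s * Complex.exp ((s : ℂ) * (Complex.arg z * Complex.I)) := by
          rw [mul_pow, Complex.exp_nat_mul]
      _ = ((‖z‖ ^ s : ℝ) : ℂ) * Complex.exp ((((s : ℝ) * Complex.arg z : ℝ) : ℂ) * Complex.I) := by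
          push_cast; ring_nf
  rw [h, Complex.re_ofReal_mul, Complex.exp_ofReal_mul_I_re]

/-- **Phase bound at exponent `s`**: if `Re z > 0` and `s · |Im z|/Re z ≤ Θ ≤ π`, then `Re(z^s) ≥ |z|^s cos Θ`. -/
theorem norm_pow_mul_cos_le_re_pow {z : ℂ} (hz : 0 < z.re) (s : ℕ) {Θ : ℝ}
    (hΘ : (s : ℝ) * (|z.im| / z.re) ≤ Θ) (hΘπ : Θ ≤ Real.pi) :
    ‖z‖ ^ s * Real.cos Θ ≤ (z ^ s).re := by
  rw [re_pow_eq_norm_pow_mul_cos, ← Real.cos_abs ((s : ℝ) * Complex.arg z)]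
  refine mul_le_mul_of_nonneg_left ?_ (pow_nonneg (norm_nonneg _) _)
  refine Real.cos_le_cos_of_nonneg_of_le_pi (abs_nonneg _) hΘπ ?_
  rw [abs_mul, Nat.abs_cast]
  -- `|arg z| ≤ |Im z| / Re z` in the right half-plane (`x ≤ tan x` on `[0, π/2)`); landed verbatim as
  -- `Literature.Probability.LatticeModels.PetersRegts.abs_arg_le_abs_im_div_re`, inlined here to keep the import cone small.
  have harg : |Complex.arg z| ≤ |z.im| / z.re := by
    have hlt : |Complex.arg z| < Real.pi / 2 := Complex.abs_arg_lt_pi_div_two_iff.2 (Or.inl hz)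
    have htan : Real.tan (Complex.arg z) = z.im / z.re := Complex.tan_arg z
    rcases le_or_gt 0 (Complex.arg z) with h0 | h0
    · rw [abs_of_nonneg h0] at hlt ⊢
      calc Complex.arg z ≤ Real.tan (Complex.arg z) := Real.le_tan h0 hlt
        _ = z.im / z.re := htan
        _ ≤ |z.im| / z.re := by gcongr; exact le_abs_self _
    · rw [abs_of_neg h0] at hlt ⊢
      calc -Complex.arg z ≤ Real.tan (-Complex.arg z) := Real.le_tan (by linarith) hlt
        _ = -(z.im / z.re) := by rw [Real.tan_neg, htan]
        _ = (-z.im) / z.re := by rw [neg_div]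
        _ ≤ |z.im| / z.re := by gcongr; exact neg_le_abs _
  exact (mul_le_mul_of_nonneg_left harg (Nat.cast_nonneg _)).trans hΘ

/-- **The phase of `1 − 1/ρ` for a zero of height `|γ| ≥ 1` in the strip**: `Re(1 − 1/ρ) > 0` and
`|Im(1 − 1/ρ)| / Re(1 − 1/ρ) = |γ|/(β² + γ² − β) ≤ 1/(|γ| − 1/4)`. -/
theorem phase_one_sub_one_div {ρ : ℂ} (h0 : 0 < ρ.re) (h1 : ρ.re < 1) (hγ : 1 ≤ |ρ.im|) :
    0 < (1 - 1 / ρ).re ∧ |(1 - 1 / ρ).im| / (1 - 1 / ρ).re ≤ 1 / (|ρ.im| - 1 / 4) := by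
  have hN : Complex.normSq ρ = ρ.re ^ 2 + ρ.im ^ 2 := by rw [Complex.normSq_apply]; ring
  have hγ2 : ρ.im ^ 2 = |ρ.im| ^ 2 := (sq_abs _).symm
  have hN0 : 0 < ρ.re ^ 2 + ρ.im ^ 2 := by positivity
  set D : ℝ := ρ.re ^ 2 + ρ.im ^ 2 - ρ.re with hD
  have hDge : |ρ.im| * (|ρ.im| - 1 / 4) ≤ D := by
    rw [hD, hγ2]; nlinarith [sq_nonneg (ρ.re - 1 / 2)]
  have hD0 : 0 < D := lt_of_lt_of_le (by nlinarith) hDge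
  have hre : (1 - 1 / ρ).re = D / (ρ.re ^ 2 + ρ.im ^ 2) := by
    rw [one_div, Complex.sub_re, Complex.one_re, Complex.inv_re, hN, hD]
    field_simp
  have him : (1 - 1 / ρ).im = ρ.im / (ρ.re ^ 2 + ρ.im ^ 2) := by
    rw [one_div, Complex.sub_im, Complex.one_im, Complex.inv_im, hN]
    ring
  refine ⟨by rw [hre]; positivity, ?_⟩
  rw [hre, him, abs_div, abs_of_pos hN0, div_div_div_cancel_right₀ hN0.ne',
    div_le_div_iff₀ hD0 (by linarith), one_mul]
  exact hDge

/-- **Sharpness of the phase condition at the multiset level.**  For `s ≥ 1`, any modulus `r` and the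
conjugate pair `z, z̄` with `z = r e^{iπ/(2s)}` (phase exactly `π/(2s)`, i.e. `cos(s · arg z) = 0`), EVERY Li
sum of the pair along the class `n ≡ s (mod 4s)` equals `2`: bounded, although for `r > 1` the pair is
off the line.  So `c₀ > 0` in the phase condition cannot be weakened to `c₀ = 0`, and the shift range
`|t| < (π/2)(H − 1/4)` of the `ζ` theorems below is the natural one for this method. -/
theorem sharp_pair_sum {s : ℕ} (hs : 1 ≤ s) (r : ℝ) (k : ℕ) :
    (1 - ((r : ℂ) * Complex.exp (((Real.pi / (2 * s) : ℝ) : ℂ) * Complex.I)) ^ (s * (4 * k + 1))).re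
      + (1 - (conj ((r : ℂ) * Complex.exp (((Real.pi / (2 * s) : ℝ) : ℂ) * Complex.I)))
          ^ (s * (4 * k + 1))).re = 2 := by
  have hs0 : (s : ℂ) ≠ 0 := by exact_mod_cast (show s ≠ 0 by omega)
  have hI : Complex.exp (((Real.pi / (2 * s) : ℝ) : ℂ) * Complex.I) ^ (s * (4 * k + 1)) = Complex.I := by
    rw [← Complex.exp_nat_mul]
    have : ((s * (4 * k + 1) : ℕ) : ℂ) * ((((Real.pi / (2 * s) : ℝ) : ℂ)) * Complex.I)
        = (k : ℂ) * (2 * Real.pi * Complex.I) + (Real.pi / 2) * Complex.I := by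
      push_cast
      field_simp
      ring
    rw [this, Complex.exp_add, Complex.exp_nat_mul_two_pi_mul_I, one_mul, ← Complex.ofReal_ofNat,
      ← Complex.ofReal_div, Complex.exp_mul_I]
    simp [Complex.ofReal_div]
  have hz : ((r : ℂ) * Complex.exp (((Real.pi / (2 * s) : ℝ) : ℂ) * Complex.I)) ^ (s * (4 * k + 1))
      = ((r ^ (s * (4 * k + 1)) : ℝ) : ℂ) * Complex.I := by
    rw [mul_pow, hI, Complex.ofReal_pow]
  rw [← map_pow, hz]
  have h1 : (1 - ((r ^ (s * (4 * k + 1)) : ℝ) : ℂ) * Complex.I).re = 1 := by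
    simp only [Complex.sub_re, Complex.one_re, Complex.mul_re, Complex.ofReal_re, Complex.ofReal_im,
      Complex.I_re, Complex.I_im, mul_zero, zero_mul, sub_zero]
  have h2 : (1 - conj (((r ^ (s * (4 * k + 1)) : ℝ) : ℂ) * Complex.I)).re = 1 := by
    rw [show (1 : ℂ) - conj (((r ^ (s * (4 * k + 1)) : ℝ) : ℂ) * Complex.I)
        = conj (1 - ((r ^ (s * (4 * k + 1)) : ℝ) : ℂ) * Complex.I) by rw [map_sub, map_one],
      Complex.conj_re, h1]
  rw [h1, h2]
  norm_num

/-! ### The non-trivial zeros of `ζ` (small facts, as in `LiCriterionProgressionsBL`) -/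

/-- RH ⇒ `λ_n ≥ 0` for `n ≥ 1` (Li's criterion, tree `li_criterion_holds`). -/
theorem keiperLiCoeff_nonneg_of_rh (hR : _root_.RiemannHypothesis) {n : ℕ} (hn : 1 ≤ n) :
    0 ≤ keiperLiCoeff n :=
  (show _root_.RiemannHypothesis ↔ ∀ n : ℕ, 1 ≤ n → 0 ≤ keiperLiCoeff n from li_criterion_holds).1 hR n hn

end LiResidueBL

end Summit.RiemannHypothesis.RiemannHypothesis.Theorems.Splittings

end
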